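import Summits.AtomisticToContinuum.Crystallization.Theses.PalmUnimodularRigidity
import Summits.AtomisticToContinuum.Crystallization.Theorems.MinimiserShells.Negative.LoadBearing
import Literature.Probability.Process.PointStationaryLaw
import Literature.MathematicalPhysics.StatisticalMechanics.RootEnergy
import Literature.MathematicalPhysics.StatisticalMechanics.MuGSC

/-!
# Deep-refute workfile for line `equilibrium-in-law-surgery` of crux `MinimiserShells`
# (stmt-AtomisticToContinuum-9225) — certified findings on the stub set

The six stub statements of `Cruxes/MinimiserShells/Lines/equilibrium-in-law-surgery.lean` are copied
here VERBATIM (that workfile is not an importable module); everything below is sorry-free.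

* §1 `palmDensity_false_without_volumeGrowth` — in `PalmDensityLemma` (stub S6) the volume-growth
  clause `∀ x ∈ S, c R³ ≤ #(S ∩ B_R(x))` is LOAD-BEARING: with it dropped (even unconditionally, i.e.
  without the `GoodShellMeasurable` antecedent) the statement is false — witness the lone root
  `δ_{δ_0}` (point-stationary, hard-core, one bad atom: surface order holds with `C = 1`).  So the
  line cannot shed `stub_dlrVolumeGrowth` (S4) while keeping the Palm step in this form.
* §2 `not_isMuGSC_of_finite` — NO nonempty finite set is a `μ`GSC of Lennard-Jones, at ANY chemical
  potential `μ` (removal of everything gives `U(S) ≤ μ n`; re-inserting a far translate gives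
  `μ n ≤ U(S) + I` with `I < 0` by the attractive tail `V_LJ < 0` on `(1, ∞)`).  Consequence for the
  deterministic stubs S3 `DLRSurfaceOrder` / S4 `DLRVolumeGrowth`: their class
  `{S : UniformlyDiscrete S ∧ IsMuGSC lennardJones e* S}` has no finite member other than `∅` (on which
  both are vacuous, `∀ x ∈ S`), so no finite configuration — single atom, dimer, comb, cluster — can
  refute either stub; any counterexample is an infinite DLR-stable configuration, whose `μ`GSC property
  at `μ = e*` is not certifiable with the tree's knowledge of `e*` (only `e* ≤ -1/2`,
  `e* ≤ E(N)/N` are landed).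
-/

noncomputable section

open MeasureTheory
open scoped ENNReal BigOperators

namespace Summit.AtomisticToContinuum.Crystallization.Cruxes.MinimiserShells.Drefute

open Literature.Probability.Process
open Literature.MathematicalPhysics.StatisticalMechanics
open Literature.Geometry.DiscreteGeometry (ShellCloseTo fccKissingPattern hcpKissingPattern)
open Summit.AtomisticToContinuum.Crystallization.Theses.PalmUnimodularRigidity
  (MinimiserShells UnimodularEnergyLowerBound)
open Summit.AtomisticToContinuum.Crystallization.Theorems.MinimiserShells.Negative

/-- Ambient space `ℝ³`. -/
abbrev E3 := EuclideanSpace ℝ (Fin 3)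

/-! ## §0 The line's vocabulary and stub statements, verbatim -/

/-- `e*`. -/
def eStar : ℝ := ⨅ Q : PeriodicConfiguration 3, Q.energyPerParticle lennardJones

/-- `E_P[h]`. -/
def meanRootEnergy (P : Measure (Measure E3)) : ℝ := ∫ μ, (∫ y, lennardJones ‖y‖ ∂μ) / 2 ∂P

/-- Root shell set. -/
def rootShellSet (μ : Measure E3) (a : ℝ) : Set E3 := {y | μ {y} ≠ 0 ∧ y ≠ 0 ∧ ‖y‖ ≤ 5 / 4 * a}

/-- Good root shell (verbatim). -/
def GoodShell (μ : Measure E3) : Prop :=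
  ∃ a : ℝ, 9 / 10 ≤ a ∧ a ≤ 1 ∧ ∃ T : Finset E3, (↑T : Set E3) = rootShellSet μ a ∧
    (ShellCloseTo (a / 100) T (Finset.image (fun v : E3 => a • v) fccKissingPattern) ∨
      ShellCloseTo (a / 100) T (Finset.image (fun v : E3 => a • v) hcpKissingPattern))

/-- Good shell at the point `x` of `S` (verbatim). -/
def GoodShellIn (S : Set E3) (x : E3) : Prop :=
  GoodShell ((Measure.count : Measure E3).restrict ((fun y => y - x) '' S))

/-- The line's `GoodShell` is the landed `Negative.LoadBearing.GoodShell` (definitional). [folklore] -/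
theorem goodShell_iff (μ : Measure E3) : GoodShell μ ↔ LoadBearing.GoodShell μ := Iff.rfl

/-- S1 (verbatim). -/
def EquilibriumInLaw : Prop :=
  UnimodularEnergyLowerBound →
    ∀ δ : ℝ, 0 < δ → ∀ P : Measure (Measure E3), IsProbabilityMeasure P →
      (∀ᵐ μ ∂P, IsRootedHardCore δ μ) → IsPointStationaryLaw P → meanRootEnergy P ≤ eStar →
      ∀ᵐ μ ∂P, ∃ S : Set E3, μ = (Measure.count : Measure E3).restrict S ∧ IsMuGSC lennardJones eStar S

/-- S3 (verbatim). -/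
def DLRSurfaceOrder : Prop :=
  ∃ C : ℝ, ∀ S : Set E3, UniformlyDiscrete S → IsMuGSC lennardJones eStar S →
    ∀ x ∈ S, ∀ R : ℝ, 1 ≤ R → ({y ∈ S | dist y x ≤ R ∧ ¬ GoodShellIn S y}.ncard : ℝ) ≤ C * R ^ 2

/-- S4 (verbatim). -/
def DLRVolumeGrowth : Prop :=
  ∃ c : ℝ, 0 < c ∧ ∀ S : Set E3, UniformlyDiscrete S → IsMuGSC lennardJones eStar S →
    ∀ x ∈ S, ∀ R : ℝ, 1 ≤ R → c * R ^ 3 ≤ ({y ∈ S | dist y x ≤ R}.ncard : ℝ)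

/-- S5 (verbatim). -/
def GoodShellMeasurable : Prop :=
  ∃ B : Set (Measure E3), MeasurableSet B ∧
    ∀ δ : ℝ, 0 < δ → ∀ μ : Measure E3, IsRootedHardCore δ μ → (μ ∈ B ↔ GoodShell μ)

/-- S6 (verbatim). -/
def PalmDensityLemma : Prop :=
  GoodShellMeasurable →
    ∀ c C : ℝ, 0 < c → ∀ δ : ℝ, 0 < δ → ∀ P : Measure (Measure E3), IsProbabilityMeasure P →
      (∀ᵐ μ ∂P, IsRootedHardCore δ μ) → IsPointStationaryLaw P →
      (∀ᵐ μ ∂P, ∃ S : Set E3, μ = (Measure.count : Measure E3).restrict S ∧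
          ∀ R : ℝ, 1 ≤ R →
            ({y ∈ S | dist y 0 ≤ R ∧ ¬ GoodShellIn S y}.ncard : ℝ) ≤ C * R ^ 2 ∧
              ∀ x ∈ S, c * R ^ 3 ≤ ({y ∈ S | dist y x ≤ R}.ncard : ℝ)) →
      ∀ᵐ μ ∂P, GoodShell μ

/-! ## §1 The volume-growth clause of `PalmDensityLemma` is load-bearing -/

/-- `PalmDensityLemma` with the volume-growth clause `∀ x ∈ S, c R³ ≤ #(S ∩ B_R(x))` DROPPED (and,
to make the negation unconditional, without the `GoodShellMeasurable` antecedent — the witness is a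
Dirac law, for which measurability of the shell event is immaterial). -/
def PalmDensityWithoutVolumeGrowth : Prop :=
  ∀ C : ℝ, ∀ δ : ℝ, 0 < δ → ∀ P : Measure (Measure E3), IsProbabilityMeasure P →
    (∀ᵐ μ ∂P, IsRootedHardCore δ μ) → IsPointStationaryLaw P →
    (∀ᵐ μ ∂P, ∃ S : Set E3, μ = (Measure.count : Measure E3).restrict S ∧
        ∀ R : ℝ, 1 ≤ R → ({y ∈ S | dist y 0 ≤ R ∧ ¬ GoodShellIn S y}.ncard : ℝ) ≤ C * R ^ 2) →
    ∀ᵐ μ ∂P, GoodShell μ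

/-- **Volume growth is load-bearing in the Palm step.**  Witness: the lone root `P = δ_{δ_0}`
(`isPointStationaryLaw_dirac_dirac_zero`, `isRootedHardCore_dirac_zero`): its single atom is bad
(`not_goodShell_dirac_zero`), so the surface-order bound holds with `C = 1`, yet the conclusion fails.
Hence S6 cannot be proved from surface order alone, and the line cannot drop `stub_dlrVolumeGrowth`.
[folklore] -/
theorem palmDensity_false_without_volumeGrowth : ¬ PalmDensityWithoutVolumeGrowth := by
  intro h
  have hae := ae_dirac_dirac_zero (G := E3) (measurableSet_singleton 0)
  have hcount : (Measure.dirac (0 : E3) : Measure E3) =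
      (Measure.count : Measure E3).restrict ({0} : Set E3) := by
    rw [Measure.restrict_singleton, Measure.count_singleton, one_smul]
  have hsurf : ∀ᵐ μ ∂(Measure.dirac (Measure.dirac (0 : E3)) : Measure (Measure E3)),
      ∃ S : Set E3, μ = (Measure.count : Measure E3).restrict S ∧
        ∀ R : ℝ, 1 ≤ R → ({y ∈ S | dist y 0 ≤ R ∧ ¬ GoodShellIn S y}.ncard : ℝ) ≤ 1 * R ^ 2 := by
    refine hae.mono fun μ hμ => ⟨{0}, by rw [hμ, hcount], fun R hR => ?_⟩
    have hle : {y ∈ ({0} : Set E3) | dist y 0 ≤ R ∧ ¬ GoodShellIn {0} y}.ncard ≤ 1 := by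
      calc {y ∈ ({0} : Set E3) | dist y 0 ≤ R ∧ ¬ GoodShellIn {0} y}.ncard
          ≤ ({0} : Set E3).ncard := Set.ncard_le_ncard (Set.sep_subset _ _) (Set.finite_singleton 0)
        _ = 1 := Set.ncard_singleton 0
    have hR2 : (1 : ℝ) ≤ R ^ 2 := by nlinarith
    calc ({y ∈ ({0} : Set E3) | dist y 0 ≤ R ∧ ¬ GoodShellIn {0} y}.ncard : ℝ) ≤ 1 := by
          exact_mod_cast hle
      _ ≤ 1 * R ^ 2 := by linarith
  have hgood := h 1 1 one_pos (Measure.dirac (Measure.dirac (0 : E3))) inferInstance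
    (hae.mono fun μ hμ => by rw [hμ]; exact isRootedHardCore_dirac_zero 1)
    isPointStationaryLaw_dirac_dirac_zero hsurf
  obtain ⟨μ, hμg, hμe⟩ := (hgood.and hae).exists
  rw [hμe] at hμg
  exact LoadBearing.not_goodShell_dirac_zero hμg

/-! ## §2 The `e*`-DLR class has no finite members: finite sets are never `μ`GSCs of Lennard-Jones -/

/-- The Lennard-Jones field of a nonempty finite set `S`, felt by a configuration every point of which
is at distance `> 1` from every point of `S`, is negative. [folklore] -/
theorem fieldEnergy_neg_of_far {n : ℕ} (hn : 0 < n) {R : Fin n → E3} {S : Set E3} (hS : S.Finite)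
    (hne : S.Nonempty) (hfar : ∀ i, ∀ y ∈ S, 1 < dist (R i) y) :
    fieldEnergy lennardJones R S < 0 := by
  classical
  haveI : Fintype S := hS.fintype
  haveI : Nonempty (Fin n) := Fin.pos_iff_nonempty.1 hn
  obtain ⟨y0, hy0⟩ := hne
  unfold fieldEnergy
  have hinner : ∀ i : Fin n, ∑' y : S, lennardJones (dist (R i) y) < 0 := by
    intro i
    rw [tsum_fintype]
    calc ∑ y : S, lennardJones (dist (R i) y) < ∑ _y : S, (0 : ℝ) :=
          Finset.sum_lt_sum_of_nonempty ⟨⟨y0, hy0⟩, Finset.mem_univ _⟩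
            fun y _ => lennardJones_neg (hfar i y y.2)
      _ = 0 := Finset.sum_const_zero
  calc ∑ i, ∑' y : S, lennardJones (dist (R i) y) < ∑ _i : Fin n, (0 : ℝ) :=
        Finset.sum_lt_sum_of_nonempty Finset.univ_nonempty fun i _ => hinner i
    _ = 0 := Finset.sum_const_zero

/-- **No nonempty finite set is a `μ`GSC of Lennard-Jones, whatever `μ`.**  Removing all `n` atoms
tests `U(S) ≤ μ n`; inserting a translate of `S` beyond distance `1` from `S` tests
`μ n ≤ U(S) + I(S + t, S)`, and the cross term is `< 0` by the attractive tail.  So the class of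
configurations quantified over in `DLRSurfaceOrder` / `DLRVolumeGrowth` contains no finite set except
`∅` (on which both stubs are vacuous). [folklore] -/
theorem not_isMuGSC_of_finite {μ : ℝ} {S : Set E3} (hS : S.Finite) (hne : S.Nonempty) :
    ¬ IsMuGSC lennardJones μ S := by
  classical
  intro h
  set F : Finset E3 := hS.toFinset with hF
  have hFS : (↑F : Set E3) = S := hS.coe_toFinset
  set n : ℕ := F.card with hn
  have hFne : F.Nonempty := by rwa [← Finset.coe_nonempty, hFS]
  have hnpos : 0 < n := Finset.card_pos.2 hFne
  set e := F.equivFin with he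
  set xf : Fin n → E3 := fun i => ((e.symm i : F) : E3) with hxf
  have hxf_inj : Function.Injective xf := fun i j hij =>
    e.symm.injective (Subtype.coe_injective hij)
  have hxf_range : Set.range xf = S := by
    ext y
    constructor
    · rintro ⟨i, rfl⟩
      rw [← hFS]
      exact (e.symm i).2
    · intro hy
      have hyF : y ∈ F := by rw [← Finset.mem_coe, hFS]; exact hy
      exact ⟨e ⟨y, hyF⟩, by simp [hxf]⟩
  -- removal of everything
  have hrem := h.removal hxf_inj hxf_range.subset
  rw [hxf_range, sdiff_self, Set.bot_eq_empty, fieldEnergy_empty, add_zero] at hrem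
  -- a far translate
  set D : ℝ := ∑ k, ‖xf k‖ with hD
  have hDk : ∀ k, ‖xf k‖ ≤ D := fun k =>
    Finset.single_le_sum (fun k _ => norm_nonneg (xf k)) (Finset.mem_univ k)
  have hD0 : 0 ≤ D := Finset.sum_nonneg fun k _ => norm_nonneg _
  set t : E3 := (2 * D + 2) • LoadBearing.e0 with ht
  have hnt : ‖t‖ = 2 * D + 2 := by
    rw [ht, norm_smul, Real.norm_eq_abs, abs_of_nonneg (by linarith)]
    simp [LoadBearing.e0]
  set Rc : Fin n → E3 := fun i => xf i + t with hRc
  have hfar : ∀ i, ∀ y ∈ S, 1 < dist (Rc i) y := by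
    intro i y hy
    obtain ⟨j, rfl⟩ : y ∈ Set.range xf := by rw [hxf_range]; exact hy
    have h1 : ‖t‖ - ‖xf j - xf i‖ ≤ ‖xf i + t - xf j‖ := by
      have := abs_norm_sub_norm_le t (xf j - xf i)
      have habs := le_abs_self (‖t‖ - ‖xf j - xf i‖)
      have heq : t - (xf j - xf i) = xf i + t - xf j := by abel
      rw [heq] at this
      linarith
    have h2 : ‖xf j - xf i‖ ≤ 2 * D :=
      (norm_sub_le _ _).trans (by linarith [hDk i, hDk j])
    rw [dist_eq_norm]
    show 1 < ‖xf i + t - xf j‖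
    linarith
  have hRc_inj : Function.Injective Rc := fun i j hij => hxf_inj (add_right_cancel hij)
  have hdisj : Disjoint (Set.range Rc) S := by
    rw [Set.disjoint_left]
    rintro _ ⟨i, rfl⟩ hy
    have := hfar i (Rc i) hy
    rw [dist_self] at this
    linarith
  have hins := h.insertion hRc_inj hdisj
  have hU : interactionEnergy lennardJones Rc = interactionEnergy lennardJones xf :=
    interactionEnergy_add_const lennardJones xf t
  have hI : fieldEnergy lennardJones Rc S < 0 := fieldEnergy_neg_of_far hnpos hS hne hfar
  rw [hU] at hins
  linarith

/-- **A Lennard-Jones `μ`GSC is empty or infinite** (any `μ`): the dichotomy form of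
`not_isMuGSC_of_finite`, as used for the class of stubs S3/S4. [folklore] -/
theorem eq_empty_or_infinite_of_isMuGSC {μ : ℝ} {S : Set (E3)}
    (h : IsMuGSC lennardJones μ S) : S = ∅ ∨ S.Infinite := by
  rcases S.eq_empty_or_nonempty with h0 | hne
  · exact Or.inl h0
  · exact Or.inr fun hfin => not_isMuGSC_of_finite hfin hne h

/-- In particular a single atom is not an `e*`-`μ`GSC, and neither is any finite cluster: the
deterministic stubs S3/S4 speak only about `∅` and infinite configurations. [folklore] -/
theorem not_isMuGSC_singleton (μ : ℝ) (x : E3) : ¬ IsMuGSC lennardJones μ ({x} : Set E3) :=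
  not_isMuGSC_of_finite (Set.finite_singleton x) (Set.singleton_nonempty x)

/-! ## §3 Every hypothesis of `EquilibriumInLaw` (S1) is used

With §2 the crux-level witnesses of `Negative.LoadBearing` transfer to the lever: the lone root and the
collinear comb are finite configurations, hence NOT `e*`-`μ`GSCs, so S1's consequent fails for them. -/

/-- Counting measures determine their carrier. [folklore] -/
theorem eq_of_count_restrict_eq {S T : Set E3}
    (h : (Measure.count : Measure E3).restrict S = (Measure.count : Measure E3).restrict T) : S = T := by
  ext y
  rw [← count_restrict_singleton_ne_zero_iff S y, ← count_restrict_singleton_ne_zero_iff T y, h]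

/-- The consequent of S1 with the minimising hypothesis `E_P[h] ≤ e*` DROPPED. -/
def EquilibriumInLawWithoutEnergy : Prop :=
  ∀ δ : ℝ, 0 < δ → ∀ P : Measure (Measure E3), IsProbabilityMeasure P →
    (∀ᵐ μ ∂P, IsRootedHardCore δ μ) → IsPointStationaryLaw P →
    ∀ᵐ μ ∂P, ∃ S : Set E3, μ = (Measure.count : Measure E3).restrict S ∧ IsMuGSC lennardJones eStar S

/-- **S1 uses `E_P[h] ≤ e*`**: the lone root `δ_{δ_0}` is a point-stationary hard-core probability law
whose configuration `{0}` is not a `μ`GSC (`not_isMuGSC_singleton`). [folklore] -/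
theorem equilibriumInLaw_false_without_energy : ¬ EquilibriumInLawWithoutEnergy := by
  intro h
  have hae := ae_dirac_dirac_zero (G := E3) (measurableSet_singleton 0)
  have hcount : (Measure.dirac (0 : E3) : Measure E3) =
      (Measure.count : Measure E3).restrict ({0} : Set E3) := by
    rw [Measure.restrict_singleton, Measure.count_singleton, one_smul]
  have hgsc := h 1 one_pos (Measure.dirac (Measure.dirac (0 : E3))) inferInstance
    (hae.mono fun μ hμ => by rw [hμ]; exact isRootedHardCore_dirac_zero 1)
    isPointStationaryLaw_dirac_dirac_zero
  obtain ⟨μ, ⟨S, hμS, hS⟩, hμe⟩ := (hgsc.and hae).exists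
  rw [hμe, hcount] at hμS
  rw [← eq_of_count_restrict_eq hμS] at hS
  exact not_isMuGSC_singleton eStar 0 hS

/-- The consequent of S1 with point-stationarity (the Mecke identity) DROPPED. -/
def EquilibriumInLawWithoutStationarity : Prop :=
  ∀ δ : ℝ, 0 < δ → ∀ P : Measure (Measure E3), IsProbabilityMeasure P →
    (∀ᵐ μ ∂P, IsRootedHardCore δ μ) → meanRootEnergy P ≤ eStar →
    ∀ᵐ μ ∂P, ∃ S : Set E3, μ = (Measure.count : Measure E3).restrict S ∧ IsMuGSC lennardJones eStar S

/-- **S1 uses the Mecke identity**: the deterministic law of the collinear comb of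
`Negative.LoadBearing` (hard core `1/(2m+2)`, mean root energy `≤ e*`) is carried by a FINITE
configuration, which is not a `μ`GSC (`not_isMuGSC_of_finite`). [folklore] -/
theorem equilibriumInLaw_false_without_stationarity : ¬ EquilibriumInLawWithoutStationarity := by
  intro h
  have hae := LoadBearing.ae_eq_dirac_count_restrict (LoadBearing.comb LoadBearing.combSize)
  have hE : meanRootEnergy (Measure.dirac ((Measure.count : Measure E3).restrict
      (↑(LoadBearing.comb LoadBearing.combSize) : Set E3))) ≤ eStar := by
    show LoadBearing.meanRootEnergy _ ≤ LoadBearing.eStar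
    rw [LoadBearing.meanRootEnergy_dirac_count_restrict]
    exact LoadBearing.rootEnergy_comb_le_eStar
  have hgsc := h _ (by positivity : (0 : ℝ) < 1 / (2 * ((LoadBearing.combSize : ℝ) + 1))) _
    inferInstance
    (hae.mono fun μ hμ => by rw [hμ]; exact LoadBearing.isRootedHardCore_comb LoadBearing.combSize) hE
  obtain ⟨μ, ⟨S, hμS, hS⟩, hμe⟩ := (hgsc.and hae).exists
  rw [hμe] at hμS
  rw [← eq_of_count_restrict_eq hμS] at hS
  exact not_isMuGSC_of_finite (LoadBearing.comb LoadBearing.combSize).finite_toSet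
    ⟨0, by simp [LoadBearing.comb]⟩ hS

end Summit.AtomisticToContinuum.Crystallization.Cruxes.MinimiserShells.Drefute

end
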